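import Mathlib
import HarnessLib

/-!
# ValiantsHypothesis / MonotoneRestoration — `MonotoneRestorationQP`, line `Sketch`, stub D6

Support file for crux item `stmt-ValiantsHypothesis-15886`
(`Summit.ValiantsHypothesis.ValiantsHypothesis.Theses.MonotoneRestoration.MonotoneRestorationQP`),
line `Sketch`, stub `stub_commutingRealisation` (exchangeable scans have COMMUTING realisations).

Setting: a linear representation (`u`, `A`, `v`) of a series on words over an alphabet `ι`: the
coefficient of the word `l = [l₀, …, lₘ₋₁]` is `u ⬝ᵥ (A l₀ * ⋯ * A lₘ₋₁) *ᵥ v`. If the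
coefficients are invariant under permutations of the word (exchangeability), the
Schützenberger–Fliess minimal realisation has pairwise commuting matrices. The construction, all
finite-dimensional linear algebra over the field `K`:
* `R` = span of the reachable vectors `A(l) *ᵥ v`; it contains `v` and is `A a`-invariant;
* `N` = the unobservable vectors `{x | ∀ l, u ⬝ᵥ A(l) *ᵥ x = 0}`; it is `A a`-invariant and
  `u ⬝ᵥ x = 0` on it;
* exchangeability gives `A a (A b x) - A b (A a x) ∈ N` for `x ∈ R` (the words
  `l' ++ a :: b :: l` and `l' ++ b :: a :: l` are permutations of each other);
* on `V := R ⧸ (R ⊓ N)` the induced operators `μ a` commute, `u ⬝ᵥ ·` descends to `ū` and `v`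
  to `v̄`; in a basis `b` of `V` (`dim V ≤ dim R ≤ w`) the matrices `A' a` of the `μ a`, the
  covector `u' i := ū (b i)` and the coordinate vector `v'` of `v̄` have the same coefficients;
* `A' a = Pm * A a * Qm`, where `Qm` is the matrix of a section `V → (Fin w → K)` through
  representatives in `R` of the basis vectors and `Pm` is the matrix of a linear extension to
  `Fin w → K` of the projection `R → V` (`LinearMap.exists_extend`).

Sources: M.-P. Schützenberger, *On the definition of a family of automata* (1961), and
J. Berstel – C. Reutenauer, *Noncommutative Rational Series with Applications*, Ch. 2 (minimal
linear representations); the commutation of minimal realisations of commutative series is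
M. Fliess' remark. Here everything is proved from scratch (Mathlib quotients and
`LinearMap.toMatrix`).
-/

-- `Summit.ValiantsHypothesis.ValiantsHypothesis.…` is the tree's mandated single-conjunct layout
-- (Sub = Summit), so the duplicated namespace component is intended.
set_option linter.dupNamespace false

noncomputable section

namespace Summit.ValiantsHypothesis.ValiantsHypothesis.Theorems

open Matrix

/-- Words of endomorphisms in coordinates: for a basis `b` of `V` and endomorphisms `μ a`, the
product along a word `l` of the matrices `LinearMap.toMatrix b b (μ a)` sends the coordinate
vector of `y` to the coordinate vector of `(μ l₀ ∘ ⋯ ∘ μ lₘ₋₁) y`. [folklore] -/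
theorem prod_map_toMatrix_mulVec_repr {K : Type} [CommRing K] {ι n V : Type} [Fintype n]
    [DecidableEq n] [AddCommGroup V] [Module K V] (b : Module.Basis n K V) (μ : ι → V →ₗ[K] V)
    (y : V) : ∀ l : List ι,
    (l.map fun a => LinearMap.toMatrix b b (μ a)).prod *ᵥ ⇑(b.repr y) =
      ⇑(b.repr ((l.map μ).prod y))
  | [] => by simp
  | a :: l => by
    rw [List.map_cons, List.prod_cons, ← Matrix.mulVec_mulVec,
      prod_map_toMatrix_mulVec_repr b μ y l, LinearMap.toMatrix_mulVec_repr, List.map_cons,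
      List.prod_cons, Module.End.mul_apply]

/-- Pairings in coordinates: the vector `i ↦ φ (b i)` of values of a linear form `φ` on a basis
`b`, dotted with the coordinate vector of `y`, gives `φ y`. [folklore] -/
theorem dotProduct_repr_eq {K : Type} [CommRing K] {n V : Type} [Fintype n] [AddCommGroup V]
    [Module K V] (b : Module.Basis n K V) (φ : V →ₗ[K] K) (y : V) :
    (fun i => φ (b i)) ⬝ᵥ ⇑(b.repr y) = φ y := by
  conv_rhs => rw [← b.sum_repr y]
  simp only [dotProduct, map_sum, map_smul, smul_eq_mul]
  exact Finset.sum_congr rfl fun i _ => mul_comm _ _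

/-- Intertwining along words: if `π` intertwines `ρ a` with `μ a` for every letter `a`
(`μ a ∘ π = π ∘ ρ a`), then it intertwines the products along every word. [folklore] -/
theorem prod_map_apply_of_semiconj {K : Type} [CommRing K] {ι V W : Type} [AddCommGroup V]
    [Module K V] [AddCommGroup W] [Module K W] (π : V →ₗ[K] W) (ρ : ι → V →ₗ[K] V)
    (μ : ι → W →ₗ[K] W) (h : ∀ a x, μ a (π x) = π (ρ a x)) (x : V) :
    ∀ l : List ι, (l.map μ).prod (π x) = π ((l.map ρ).prod x)
  | [] => by simp
  | a :: l => by
    rw [List.map_cons, List.prod_cons, Module.End.mul_apply,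
      prod_map_apply_of_semiconj π ρ μ h x l, h, List.map_cons, List.prod_cons,
      Module.End.mul_apply]

/-- Intertwining along words, matrix form: if `A a *ᵥ π x = π (ρ a x)` for every letter `a`,
then `A(l) *ᵥ π x = π (ρ(l) x)` for every word `l`. [folklore] -/
theorem prod_map_mulVec_of_semiconj {K : Type} [CommRing K] {ι V : Type} {w : ℕ}
    [AddCommGroup V] [Module K V] (π : V →ₗ[K] (Fin w → K)) (ρ : ι → V →ₗ[K] V)
    (A : ι → Matrix (Fin w) (Fin w) K) (h : ∀ a x, A a *ᵥ π x = π (ρ a x)) (x : V) :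
    ∀ l : List ι, (l.map A).prod *ᵥ π x = π ((l.map ρ).prod x)
  | [] => by simp
  | a :: l => by
    rw [List.map_cons, List.prod_cons, ← Matrix.mulVec_mulVec,
      prod_map_mulVec_of_semiconj π ρ A h x l, h, List.map_cons, List.prod_cons,
      Module.End.mul_apply]

/-- Scan values of spliced words: the value of the prefix `l'`, then the letters `a`, `b`, then
the suffix `l`, is the value of the word `l' ++ a :: b :: l`. [folklore] -/
theorem dotProduct_prod_map_splice {K : Type} [CommRing K] {ι : Type} {w : ℕ}
    (A : ι → Matrix (Fin w) (Fin w) K) (u v : Fin w → K) (l' l : List ι) (a b : ι) :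
    u ⬝ᵥ (l'.map A).prod *ᵥ ((A a * A b) *ᵥ ((l.map A).prod *ᵥ v)) =
      u ⬝ᵥ ((l' ++ a :: b :: l).map A).prod *ᵥ v := by
  simp [Matrix.mulVec_mulVec, mul_assoc]

/-- **Abstract minimal realisation.** Let `R ∋ v` be an `A`-invariant subspace (reachable
vectors) and `N ⊆ ker (u ⬝ᵥ ·)` an `A`-invariant subspace (unobservable vectors) such that every
commutator `A a A b - A b A a` maps `R` into `N`. Then the operators induced by the `A a` on
`R ⧸ (R ⊓ N)` commute pairwise, and their matrices in a basis — a fixed two-sided change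
`Pm * A a * Qm` of the `A a` — together with the induced covector and vector form a realisation
of dimension `≤ w` of the same coefficients `u ⬝ᵥ A(l) *ᵥ v`. [folklore] -/
theorem commutingRealisation_of_invariant {K : Type} [Field K] {ι : Type} {w : ℕ}
    (A : ι → Matrix (Fin w) (Fin w) K) (u v : Fin w → K) (R N : Submodule K (Fin w → K))
    (hv : v ∈ R) (hR : ∀ a, ∀ x ∈ R, A a *ᵥ x ∈ R) (hN : ∀ a, ∀ x ∈ N, A a *ᵥ x ∈ N)
    (hu : ∀ x ∈ N, u ⬝ᵥ x = 0)
    (hcomm : ∀ a b, ∀ x ∈ R, A a *ᵥ A b *ᵥ x - A b *ᵥ A a *ᵥ x ∈ N) :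
    ∃ (w' : ℕ) (A' : ι → Matrix (Fin w') (Fin w') K) (u' v' : Fin w' → K)
      (Pm : Matrix (Fin w') (Fin w) K) (Qm : Matrix (Fin w) (Fin w') K),
      w' ≤ w ∧ (∀ a b, A' a * A' b = A' b * A' a) ∧ (∀ a, A' a = Pm * A a * Qm) ∧
      ∀ l : List ι, u' ⬝ᵥ ((l.map A').prod).mulVec v' = u ⬝ᵥ ((l.map A).prod).mulVec v := by
  classical
  -- (1) the transfer operators restricted to the reachable space `R`
  obtain ⟨ρ, hρ⟩ : ∃ ρ : ι → R →ₗ[K] R, ∀ a (x : R), ((ρ a x : R) : Fin w → K) = A a *ᵥ x :=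
    ⟨fun a => (Matrix.toLin' (A a)).restrict fun x hx =>
        show Matrix.toLin' (A a) x ∈ R by rw [Matrix.toLin'_apply]; exact hR a x hx,
      fun a x => rfl⟩
  -- (2) the unobservable subspace pulled back to `R`; it is `ρ a`-invariant
  obtain ⟨N', hN'⟩ : ∃ N' : Submodule K R, ∀ x : R, x ∈ N' ↔ (x : Fin w → K) ∈ N :=
    ⟨N.comap R.subtype, fun x => Iff.rfl⟩
  have hρN' : ∀ a, N' ≤ N'.comap (ρ a) := fun a x hx => by
    rw [Submodule.mem_comap, hN', hρ]
    exact hN a _ ((hN' x).1 hx)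
  -- (3) the operators induced on the quotient `V := R ⧸ N'` commute
  obtain ⟨μ, hμ⟩ : ∃ μ : ι → (R ⧸ N') →ₗ[K] (R ⧸ N'),
      ∀ a (x : R), μ a (N'.mkQ x) = N'.mkQ (ρ a x) :=
    ⟨fun a => N'.mapQ N' (ρ a) (hρN' a), fun a x => rfl⟩
  have hμcomm : ∀ a b, μ a * μ b = μ b * μ a := by
    intro a b
    refine Submodule.linearMap_qext N' (LinearMap.ext fun x => ?_)
    simp only [LinearMap.comp_apply, Module.End.mul_apply, hμ]
    rw [Submodule.mkQ_apply, Submodule.mkQ_apply, Submodule.Quotient.eq, hN']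
    simpa only [Submodule.coe_sub, hρ] using hcomm a b x x.2
  -- (4) the covector descends to the quotient
  obtain ⟨ū, hū⟩ : ∃ ū : (R ⧸ N') →ₗ[K] K, ∀ x : R, ū (N'.mkQ x) = u ⬝ᵥ (x : Fin w → K) := by
    refine ⟨N'.liftQ ((dotProductBilin K K u).comp R.subtype) fun x hx => ?_, fun x => rfl⟩
    rw [LinearMap.mem_ker, LinearMap.comp_apply, Submodule.subtype_apply]
    exact hu _ ((hN' x).1 hx)
  -- (5) a basis of the (finite-dimensional) quotient, representatives of its vectors in `R`,
  -- the section `q` through them and an extension `g` of the projection `R → R ⧸ N'`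
  set n : ℕ := Module.finrank K (R ⧸ N') with hn
  set bV : Module.Basis (Fin n) K (R ⧸ N') := Module.finBasis K (R ⧸ N') with hbV
  obtain ⟨xs, hxs⟩ : ∃ xs : Fin n → R, ∀ i, N'.mkQ (xs i) = bV i :=
    ⟨fun i => (N'.mkQ_surjective (bV i)).choose,
      fun i => (N'.mkQ_surjective (bV i)).choose_spec⟩
  obtain ⟨q, hq⟩ : ∃ q : (R ⧸ N') →ₗ[K] (Fin w → K), ∀ i, q (bV i) = xs i :=
    ⟨bV.constr K fun i => ((xs i : R) : Fin w → K), fun i => by simp⟩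
  obtain ⟨g, hg⟩ := LinearMap.exists_extend N'.mkQ
  have hg' : ∀ y : R, g (y : Fin w → K) = N'.mkQ y := fun y => by
    simpa using LinearMap.congr_fun hg y
  refine ⟨n, fun a => LinearMap.toMatrix bV bV (μ a), fun i => ū (bV i),
    ⇑(bV.repr (N'.mkQ ⟨v, hv⟩)), LinearMap.toMatrix (Pi.basisFun K (Fin w)) bV g,
    LinearMap.toMatrix bV (Pi.basisFun K (Fin w)) q, ?_, ?_, ?_, ?_⟩
  · -- `w' ≤ w`
    calc n ≤ Module.finrank K R := Submodule.finrank_quotient_le N'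
      _ ≤ Module.finrank K (Fin w → K) := Submodule.finrank_le R
      _ = w := Module.finrank_fin_fun K
  · -- the matrices commute
    intro a b
    rw [← LinearMap.toMatrix_mul, ← LinearMap.toMatrix_mul, hμcomm]
  · -- `A' a = Pm * A a * Qm`
    intro a
    rw [show A a = LinearMap.toMatrix (Pi.basisFun K (Fin w)) (Pi.basisFun K (Fin w))
        (Matrix.toLin' (A a)) by rw [LinearMap.toMatrix_eq_toMatrix', LinearMap.toMatrix'_toLin'],
      ← LinearMap.toMatrix_comp, ← LinearMap.toMatrix_comp]
    refine congrArg (LinearMap.toMatrix bV bV) (bV.ext fun i => ?_)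
    rw [LinearMap.comp_apply, LinearMap.comp_apply, hq, Matrix.toLin'_apply, ← hρ, hg', ← hμ,
      hxs]
  · -- the same coefficients
    intro l
    have h3 := prod_map_mulVec_of_semiconj R.subtype ρ A (fun a x => (hρ a x).symm) ⟨v, hv⟩ l
    rw [prod_map_toMatrix_mulVec_repr bV μ _ l, dotProduct_repr_eq bV ū,
      prod_map_apply_of_semiconj N'.mkQ ρ μ hμ ⟨v, hv⟩ l, hū]
    simpa using (congrArg (u ⬝ᵥ ·) h3).symm

/-- **D6 — exchangeable scans have COMMUTING realisations** (minimal realisation of a commutative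
recognizable series; Schützenberger / Fliess): if the coefficients `u · A(l) · v`,
`A(l) = A l₀ ⋯ A lₘ₋₁`, of a linear representation are invariant under permutations of the
word `l`, then some representation of dimension `≤ w` with PAIRWISE COMMUTING matrices, obtained
by a fixed two-sided linear change `A' a = Pm · A a · Qm` (restrict to the reachable space, quotient
by the unobservable one — on that quotient `A a A b - A b A a` vanishes), has the same
coefficients. [folklore] -/
theorem stub_commutingRealisation {K : Type} [Field K] {ι : Type} {w : ℕ}
    (A : ι → Matrix (Fin w) (Fin w) K) (u v : Fin w → K)
    (hex : ∀ l l' : List ι, l.Perm l' →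
      u ⬝ᵥ ((l.map A).prod).mulVec v = u ⬝ᵥ ((l'.map A).prod).mulVec v) :
    ∃ (w' : ℕ) (A' : ι → Matrix (Fin w') (Fin w') K) (u' v' : Fin w' → K)
      (Pm : Matrix (Fin w') (Fin w) K) (Qm : Matrix (Fin w) (Fin w') K),
      w' ≤ w ∧ (∀ a b, A' a * A' b = A' b * A' a) ∧ (∀ a, A' a = Pm * A a * Qm) ∧
      ∀ l : List ι, u' ⬝ᵥ ((l.map A').prod).mulVec v' = u ⬝ᵥ ((l.map A).prod).mulVec v := by
  -- the reachable space `R`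
  set R : Submodule K (Fin w → K) :=
    Submodule.span K (Set.range fun l : List ι => (l.map A).prod *ᵥ v) with hRdef
  have hgen : ∀ l : List ι, (l.map A).prod *ᵥ v ∈ R := fun l => Submodule.subset_span ⟨l, rfl⟩
  have hv : v ∈ R := by simpa using hgen []
  have hR : ∀ a, ∀ x ∈ R, A a *ᵥ x ∈ R := by
    intro a x hx
    have hle : R ≤ R.comap (Matrix.toLin' (A a)) := by
      refine Submodule.span_le.mpr ?_
      rintro _ ⟨l, rfl⟩
      simp only [SetLike.mem_coe, Submodule.mem_comap, Matrix.toLin'_apply, Matrix.mulVec_mulVec]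
      simpa using hgen (a :: l)
    simpa using hle hx
  -- the unobservable space `N`
  obtain ⟨N, hN⟩ : ∃ N : Submodule K (Fin w → K),
      ∀ x, x ∈ N ↔ ∀ l : List ι, u ⬝ᵥ (l.map A).prod *ᵥ x = 0 := by
    refine ⟨{ carrier := {x | ∀ l : List ι, u ⬝ᵥ (l.map A).prod *ᵥ x = 0}
              add_mem' := fun {x y} hx hy l => ?_
              zero_mem' := fun l => by simp
              smul_mem' := fun c x hx l => ?_ }, fun x => Iff.rfl⟩
    · have hx' : u ⬝ᵥ (l.map A).prod *ᵥ x = 0 := hx l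
      have hy' : u ⬝ᵥ (l.map A).prod *ᵥ y = 0 := hy l
      simp [Matrix.mulVec_add, dotProduct_add, hx', hy']
    · have hx' : u ⬝ᵥ (l.map A).prod *ᵥ x = 0 := hx l
      simp [Matrix.mulVec_smul, dotProduct_smul, hx']
  have hNinv : ∀ a, ∀ x ∈ N, A a *ᵥ x ∈ N := by
    intro a x hx
    rw [hN] at hx ⊢
    intro l
    simpa [Matrix.mulVec_mulVec] using hx (l ++ [a])
  have hu : ∀ x ∈ N, u ⬝ᵥ x = 0 := fun x hx => by simpa using (hN x).1 hx []
  -- exchangeability: the commutators map `R` into `N`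
  have hcomm : ∀ a b, ∀ x ∈ R, A a *ᵥ A b *ᵥ x - A b *ᵥ A a *ᵥ x ∈ N := by
    intro a b x hx
    have hle : R ≤ N.comap (Matrix.toLin' (A a * A b - A b * A a)) := by
      refine Submodule.span_le.mpr ?_
      rintro _ ⟨l, rfl⟩
      simp only [SetLike.mem_coe, Submodule.mem_comap, Matrix.toLin'_apply, hN]
      intro l'
      rw [Matrix.sub_mulVec, Matrix.mulVec_sub, dotProduct_sub, dotProduct_prod_map_splice,
        dotProduct_prod_map_splice, sub_eq_zero]
      exact hex _ _ (List.Perm.append_left l' (List.Perm.swap b a l))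
    simpa [Matrix.sub_mulVec, Matrix.mulVec_mulVec] using hle hx
  exact commutingRealisation_of_invariant A u v R N hv hR hNinv hu hcomm

end Summit.ValiantsHypothesis.ValiantsHypothesis.Theorems

end
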